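import Summits.CriticalPhenomena.PercolationContinuityZ3.Theorems.PercNearOneGluingNoHeavyLowerTailStarSetWordDesignations
import Summits.CriticalPhenomena.PercolationContinuityZ3.Theorems.PercNearOneGluingNoHeavyLowerTailStarSetWordCaps
import Summits.CriticalPhenomena.PercolationContinuityZ3.Theorems.PercNearOneGluingNoHeavyLowerTailStarSetFamilyLoad
import Summits.CriticalPhenomena.PercolationContinuityZ3.Theorems.PercNearOneGluingNoHeavyLowerTailStarSetOmegaCliques
import HarnessLib

/-!
# `NoHeavyLowerTail` (stmt-CriticalPhenomena-4575) — the R1-rider family of the residual bound (U1-PROOF.md §6, R1; blueprint §G4)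

Support file (prover `prim-gen-swap` gen 15; `--supports stmt-CriticalPhenomena-4575`).  No definitions, no named facts, no sorries.

A residual configuration of type R1 — hub `X = {q₀, a}` a chord avoiding `r`, first open forest class the leaf class
`I₀ = {q₀, r}` (`P I₀ = q₀`, `P' I₀ = r`) — with a non-inert rider `ρ` (a class of `S ∖ {X, I₀}` avoiding `r`; it passes through `a`,
not `q₀`) requests the single-designation word `(X→a, I₀→q₀, ρ→s')` on `T = {X, I₀, ρ}` (U1-PROOF §6, R1 rider words), of capacity
`≥ t_X t_{I₀} t_ρ ≥ θ_Xθ_{I₀}θ_ρ` = the aggregate of these configurations.  The claimant of `T` is unique (the hub is the only chord of `T`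
through `q₀`), so the family is paid by the capacity of its class-sets (RID1 shape: contain the leaf class).

* `StarSet.riderR1_triple_le_cap` — `θ_Xθ_{I₀}θ_ρ ≤ C_T`;
* `StarSet.familyRiderR1_bound` — `Σ_{u∈U} W(S_u) ≤ Σ_{T ∈ res(U)} C_T`.
-/

namespace Summit.CriticalPhenomena.PercolationContinuityZ3.Theorems

open Finset
open scoped BigOperators Classical

namespace StarSet

variable {ι V : Type*} [Fintype ι] [LinearOrder ι] [DecidableEq V]

/-- **The R1-rider word: `θ_Xθ_{I₀}θ_ρ ≤ C_T`** for `T = {X, I₀, ρ}`, designation `(X→a, I₀→q₀, ρ→s')` with `a, q₀, s'` pairwise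
distinct and `≠ r`. -/
theorem riderR1_triple_le_cap (P P' : ι → V) (r : V)
    (θ : ι → ℝ) (hθ0 : ∀ X, 0 ≤ θ X) (O : ι → V → ℝ) (hO0 : ∀ X d, 0 ≤ O X d)
    (hO1 : ∀ X d, (P X = d ∨ P' X = d) → θ X ≤ (1 - θ X) * O X d)
    {X I₀ ρ : ι} (hXI : X ≠ I₀) (hXρ : X ≠ ρ) (hIρ : I₀ ≠ ρ) {a q₀ s' : V}
    (haX : P X = a ∨ P' X = a) (hqI : P I₀ = q₀ ∨ P' I₀ = q₀) (hs'ρ : P ρ = s' ∨ P' ρ = s')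
    (haq : a ≠ q₀) (has' : a ≠ s') (hqs' : q₀ ≠ s') (har : a ≠ r) (hqr : q₀ ≠ r) (hs'r : s' ≠ r) :
    θ X * θ I₀ * θ ρ ≤
      ∑ δ ∈ (univ : Finset (ι → Bool)).filter (fun δ => (∀ K ∉ ({X, I₀, ρ} : Finset ι), δ K = false) ∧
          3 ≤ (({X, I₀, ρ} : Finset ι).image fun K => if δ K then P K else P' K).card ∧
          r ∉ ({X, I₀, ρ} : Finset ι).image fun K => if δ K then P K else P' K),
        ∏ K ∈ ({X, I₀, ρ} : Finset ι), O K (if δ K then P K else P' K) := by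
  have hOX : θ X ≤ O X a := odds_ge_theta (θ X) (O X a) (hθ0 X) (hO0 _ _) (hO1 X a haX)
  have hOI : θ I₀ ≤ O I₀ q₀ := odds_ge_theta (θ I₀) (O I₀ q₀) (hθ0 I₀) (hO0 _ _) (hO1 I₀ q₀ hqI)
  have hOρ : θ ρ ≤ O ρ s' := odds_ge_theta (θ ρ) (O ρ s') (hθ0 ρ) (hO0 _ _) (hO1 ρ s' hs'ρ)
  have hw := one_word_le_cap P P' r O hO0 hXI hXρ hIρ haX hqI hs'ρ haq has' hqs' har hqr hs'r
  have h3 : θ X * θ I₀ * θ ρ ≤ O X a * O I₀ q₀ * O ρ s' :=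
    mul_le_mul (mul_le_mul hOX hOI (hθ0 _) (hO0 _ _)) hOρ (hθ0 _) (mul_nonneg (hO0 _ _) (hO0 _ _))
  exact h3.trans hw

/-- **The R1-rider family bound (U1-PROOF §6, R1).**  `I₀ ∈ F` is the leaf class (`P I₀ = q₀`, `P' I₀ = r`).  Units `(S, X)`: hub
`X = u.2 ∈ S` a chord avoiding `r` through `q₀`, `I₀ ∈ S`, and a rider `ρ = rof u ∈ S` avoiding `r`, `ρ ≠ X`, adjacent to `X` but not
through `q₀`.  Then `Σ_{u∈U} W(S_u) ≤ Σ_{T ∈ U.image {X,I₀,ρ}} C_T`. -/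
theorem familyRiderR1_bound (P P' : ι → V) (hPP' : ∀ X, P X ≠ P' X) (r : V) (F : Finset ι)
    (θ : ι → ℝ) (hθ0 : ∀ X, 0 ≤ θ X) (hθ1 : ∀ X, θ X ≤ 1) (O : ι → V → ℝ) (hO0 : ∀ X d, 0 ≤ O X d)
    (hO1 : ∀ X d, (P X = d ∨ P' X = d) → θ X ≤ (1 - θ X) * O X d)
    {I₀ : ι} {q₀ : V} (hI₀F : I₀ ∈ F) (hI₀ : P I₀ = q₀ ∧ P' I₀ = r)
    (U : Finset (Finset ι × ι)) (rof : Finset ι × ι → ι)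
    (hU : ∀ u ∈ U, u.2 ∈ u.1 ∧ u.2 ∉ F ∧ (P u.2 ≠ r ∧ P' u.2 ≠ r) ∧ (P u.2 = q₀ ∨ P' u.2 = q₀) ∧ I₀ ∈ u.1 ∧
      rof u ∈ u.1 ∧ rof u ≠ u.2 ∧ (P (rof u) ≠ r ∧ P' (rof u) ≠ r) ∧ ¬ (P (rof u) = q₀ ∨ P' (rof u) = q₀) ∧
      (P (rof u) = P u.2 ∨ P (rof u) = P' u.2 ∨ P' (rof u) = P u.2 ∨ P' (rof u) = P' u.2)) :
    ∑ u ∈ U, ((∏ k ∈ u.1, θ k) * ∏ k ∈ univ \ u.1, (1 - θ k)) ≤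
      ∑ T ∈ U.image (fun u => ({u.2, I₀, rof u} : Finset ι)),
        ∑ δ ∈ (univ : Finset (ι → Bool)).filter (fun δ => (∀ K ∉ T, δ K = false) ∧
            3 ≤ (T.image fun K => if δ K then P K else P' K).card ∧ r ∉ T.image fun K => if δ K then P K else P' K),
          ∏ K ∈ T, O K (if δ K then P K else P' K) := by
  have hqr : q₀ ≠ r := fun h => hPP' I₀ (hI₀.1.trans (h.trans hI₀.2.symm))
  have hdata : ∀ u ∈ U, u.2 ≠ I₀ ∧ I₀ ≠ rof u ∧ ∃ a s' : V,
      (P u.2 = a ∨ P' u.2 = a) ∧ (P (rof u) = a ∨ P' (rof u) = a) ∧ (P (rof u) = s' ∨ P' (rof u) = s') ∧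
      a ≠ q₀ ∧ a ≠ s' ∧ q₀ ≠ s' ∧ a ≠ r ∧ s' ≠ r := by
    intro u hu
    obtain ⟨-, hXF, hXr, hqX, -, -, hρX, hρr, hρq, hρadj⟩ := hU u hu
    have hXI : u.2 ≠ I₀ := fun h => hXF (h ▸ hI₀F)
    have hIρ : I₀ ≠ rof u := fun h => hρr.2 (h ▸ hI₀.2)
    obtain ⟨a, haX, hqa⟩ : ∃ a, (P u.2 = a ∨ P' u.2 = a) ∧ q₀ ≠ a := by
      rcases hqX with h | h
      · exact ⟨P' u.2, Or.inr rfl, fun h' => hPP' u.2 (h.trans h')⟩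
      · exact ⟨P u.2, Or.inl rfl, fun h' => hPP' u.2 (h'.symm.trans h.symm)⟩
    -- `ρ` passes through `a`
    have hρq' : P (rof u) ≠ q₀ ∧ P' (rof u) ≠ q₀ := ⟨fun h => hρq (Or.inl h), fun h => hρq (Or.inr h)⟩
    have haρ : P (rof u) = a ∨ P' (rof u) = a := by
      rcases hqX with hXq | hXq <;> rcases haX with hXa | hXa
      · exact absurd (hXq.symm.trans hXa) hqa
      · rcases hρadj with h | h | h | h
        · exact absurd (h.trans hXq) hρq'.1
        · exact Or.inl (h.trans hXa)
        · exact absurd (h.trans hXq) hρq'.2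
        · exact Or.inr (h.trans hXa)
      · rcases hρadj with h | h | h | h
        · exact Or.inl (h.trans hXa)
        · exact absurd (h.trans hXq) hρq'.1
        · exact Or.inr (h.trans hXa)
        · exact absurd (h.trans hXq) hρq'.2
      · exact absurd (hXq.symm.trans hXa) hqa
    obtain ⟨s', hs'ρ, has'⟩ : ∃ s', (P (rof u) = s' ∨ P' (rof u) = s') ∧ a ≠ s' := by
      rcases haρ with h | h
      · exact ⟨P' (rof u), Or.inr rfl, fun h' => hPP' (rof u) (h.trans h')⟩
      · exact ⟨P (rof u), Or.inl rfl, fun h' => hPP' (rof u) (h'.symm.trans h.symm)⟩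
    have hqs' : q₀ ≠ s' := by
      rintro rfl
      exact hρq hs'ρ
    have hport_r : ∀ (K : ι) (x : V), (P K ≠ r ∧ P' K ≠ r) → (P K = x ∨ P' K = x) → x ≠ r := by
      rintro K x hK (h | h)
      · rw [← h]; exact hK.1
      · rw [← h]; exact hK.2
    exact ⟨hXI, hIρ, a, s', haX, haρ, hs'ρ, hqa.symm, has', hqs', hport_r _ _ hXr haX, hport_r _ _ hρr hs'ρ⟩
  have h := family_load_le θ hθ0 hθ1 U (fun u => ({u.2, I₀, rof u} : Finset ι)) (fun u => u.2)
    (fun u => ({u.2, I₀, rof u} : Finset ι))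
    (fun T => ∑ δ ∈ (univ : Finset (ι → Bool)).filter (fun δ => (∀ K ∉ T, δ K = false) ∧
        3 ≤ (T.image fun K => if δ K then P K else P' K).card ∧ r ∉ T.image fun K => if δ K then P K else P' K),
      ∏ K ∈ T, O K (if δ K then P K else P' K))
    (fun u _ => sum_nonneg fun δ _ => prod_nonneg fun K _ => hO0 _ _) 1 1 (by norm_num)
    (fun u hu => ?_) (fun u _ v _ hres _ => hres) (fun u _ v _ _ hk huv => Prod.ext huv hk) (fun u hu => ?_) (fun w hw => ?_)
  · simpa using h
  · obtain ⟨hXS, -, -, -, hIS, hρS, -⟩ := hU u hu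
    intro k hk
    rcases mem_insert.1 hk with rfl | hk
    · exact hXS
    rcases mem_insert.1 hk with rfl | hk
    · exact hIS
    · rw [mem_singleton.1 hk]; exact hρS
  · obtain ⟨hXI, hIρ, a, s', haX, haρ, hs'ρ, haq, has', hqs', har, hs'r⟩ := hdata u hu
    obtain ⟨-, -, -, -, -, -, hρX, -⟩ := hU u hu
    have hXnot : u.2 ∉ ({I₀, rof u} : Finset ι) := by simp [hXI, Ne.symm hρX]
    rw [prod_insert hXnot, prod_pair hIρ, ← mul_assoc, div_one]
    exact riderR1_triple_le_cap P P' r θ hθ0 O hO0 hO1 hXI (Ne.symm hρX) hIρ haX (Or.inl hI₀.1) hs'ρ haq has' hqs' har hqr hs'r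
  · -- one key per class-set: the hub is the only chord of `T` through `q₀`
    refine card_le_one.2 fun a ha b hb => ?_
    obtain ⟨u, hu, rfl⟩ := mem_image.1 ha
    obtain ⟨v, hv, rfl⟩ := mem_image.1 hb
    obtain ⟨huU, huw⟩ := mem_filter.1 hu
    obtain ⟨hvU, hvw⟩ := mem_filter.1 hv
    obtain ⟨-, hXF, -, hqX, -, -, -, -, -, -⟩ := hU u huU
    obtain ⟨-, -, -, -, -, -, -, -, hρq', -⟩ := hU v hvU
    have hT : ({u.2, I₀, rof u} : Finset ι) = {v.2, I₀, rof v} := huw.trans hvw.symm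
    have h : u.2 ∈ ({v.2, I₀, rof v} : Finset ι) := by rw [← hT]; exact mem_insert_self _ _
    rcases mem_insert.1 h with h | h
    · exact h
    rcases mem_insert.1 h with h | h
    · exact absurd (h ▸ hI₀F) hXF
    · rw [mem_singleton.1 h] at hqX
      exact absurd hqX hρq'

end StarSet

end Summit.CriticalPhenomena.PercolationContinuityZ3.Theorems
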